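import Summits.BirchSwinnertonDyer.BirchSwinnertonDyer.Theorems.ByReductionTypeAtTwoFineSelmerConjAAtTwoAdditivePotGoodClassNumberOneCriterionFrac
import Summits.BirchSwinnertonDyer.BirchSwinnertonDyer.Theorems.ByReductionTypeAtTwoFineSelmerConjAAtTwoAdditivePotGoodTwoLayerStampsEvenIndexD
import HarnessLib

/-!
# Route `ByReductionTypeAtTwo` (rung K4), crux C1″ `FineSelmerConjAAtTwoAdditivePotGood` (item stmt-BirchSwinnertonDyer-22615):
# CLASS NUMBER ONE FOR THE CUBIC FIELD OF DISCRIMINANT `63644` (`X³ + (-1)X² + (-47)X + (95)`, index `2`) BY A NORM CERTIFICATE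
# (KERNEL) — the `2`-torsion point field `ℚ(P)` of the census row `445508b1`, whose two-layer stamp thereby drops to ONE displayed bit
# (a `--supports 22615` file; seat `bsd-2adic-k4-w1` GEN 6; consumer of `…ClassNumberOneCriterion` / `…ClassNumberOneCriterionFrac`)

HONEST FRAMING (cell `bsd-2adic`, D-0036/D-0054): §1 UNCONDITIONAL kernel arithmetic; §2 conditional on `hLim2` (Lim 2017 Thm. 3.5 at `2`) BY NAME
and ONE displayed bit (`e₁ = 0`, i.e. `2 ∤ h(ℚ(θ, √2))`, census `cyc6 = []`); closes nothing at the `∀`-level; nothing booked; BSD is not proved by any of this.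

THE CERTIFICATE (generated by the seat's exact-arithmetic tools — reduced model, integral basis, relation sieve with Dedekind–Kummer
bookkeeping, unit reduction — and CHECKED HERE by the kernel): `g = X³ + (-1)X² + (-47)X + (95)`, `disc g = 254576 = 2² · (63644)`;
the integral element `ω` of the proof shows `2 ∣ [𝓞 K : ℤ[θ]]`, so `|d_K| ≤ 63644` (`sq_mul_abs_discr_le_abs_cubic_discr`) and `M_K < 72`.
For every prime `ℓ < 72` and every root `a` of `g mod ℓ` the proof lists a generator `(x + yθ + zθ²)/m` of the ideals `I ∋ ℓ, θ − a` of norm `ℓ`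
(15 witnesses, 0 of them outside `ℤ[θ]`; the prime 2 dividing the index is certified through a second generator of `𝓞 K` (`exists_intElem_of_scaled_cubic`)). No Dedekind–Kummer theory is invoked in the proof: the criterion only uses `𝓞/I ≅ 𝔽_ℓ`.

References: [Marcus1977] Ch. 2 Exercise 27, Ch. 5 Thm. 35–37; [Cohen1993] §4.8.2, §6.3; [Lim2017FineSelmer] Thm. 3.5, Lemma 3.2;
[Greenberg2001IwasawaPastPresent] Prop. 2.1 (Iwasawa 1956); [Fukuda1994] Thm. 1 (1).
-/

set_option autoImplicit false
-- sibling precedent (`…ClassNumberOneCriterionFrac.lean`): the directory name repeats the summit name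
set_option linter.dupNamespace false

noncomputable section

open scoped Classical IntermediateField NumberField Real nonZeroDivisors

namespace Summit.BirchSwinnertonDyer.BirchSwinnertonDyer.Theorems.AddKatoTwo

open WeierstrassCurve Field Polynomial IsDedekindDomain NumberField Matrix Literature.NumberTheory.EllipticCurves
  Literature.NumberTheory.GaloisRepresentations
  Literature.NumberTheory.IwasawaTheory
  Summit.BirchSwinnertonDyer.BirchSwinnertonDyer.Theorems.AlignedTransportAtTwoTorsionPointField
  Summit.BirchSwinnertonDyer.BirchSwinnertonDyer.Theses.ByReductionTypeAtTwo

/-! ## §1 The certificate: `h = 1` for the field of `X³ + (-1)X² + (-47)X + (95)` -/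

section Certificate

variable (K : Type) [Field K] [NumberField K]

/-- `X³ + (-1)X² + (-47)X + (95)` is irreducible over `ℚ` (no root mod `11`). -/
theorem irreducible_cubic_d63644p_min : Irreducible (Cubic.toPoly ⟨1, ((-1 : ℤ) : ℚ), ((-47 : ℤ) : ℚ), ((95 : ℤ) : ℚ)⟩) :=
  haveI : Fact (Nat.Prime 11) := ⟨by norm_num⟩
  irreducible_cubic_of_no_root_zmod 11 (by decide)

/-- **`h = 1` for every cubic number field whose integers contain a root `θ` of `X³ + (-1)X² + (-47)X + (95)`** (`|disc| = 254576`, index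
`2`, `M_K < 72`): a norm certificate — for every prime `ℓ < 72` and every root `a` of the cubic mod `ℓ` a generator
`(x + yθ + zθ²)/m ∈ 𝓞 K` of every ideal `I ∋ ℓ, θ − a` of norm `ℓ` (listed in the proof; `m > 1` = element of `𝓞 K ∖ ℤ[θ]`, certified by its
scaled cubic identity); the primes dividing the index (2) are certified through a second generator of `𝓞 K`. KERNEL.
[cite: Marcus1977, Ch. 5 Thm. 37 and Cor. 2] [cite: Cohen1993, §6.3] -/
theorem classNumber_eq_one_of_root_d63644p (h3 : Module.finrank ℚ K = 3) (b : 𝓞 K)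
    (hb : b ^ 3 + (-1 : ℤ) * b ^ 2 + (-47 : ℤ) * b + (95 : ℤ) = 0) : NumberField.classNumber K = 1 := by
  have hirr := irreducible_cubic_d63644p_min
  -- `ω = (1 + 0θ + 1θ²)/2 ∈ 𝓞 K` witnesses `2 ∣ [𝓞 K : ℤ[θ]]`, so `2² · |d_K| ≤ |disc| = 254576`
  obtain ⟨ω, hω, -⟩ := exists_intElem_of_scaled_cubic K b 1 0 1 (m := 2) (by norm_num) (-49) 648 (-1440)
    (by push_cast; linear_combination ((-95 : 𝓞 K) + (-47 : 𝓞 K) * b + (1 : 𝓞 K) * b ^ 2 + (1 : 𝓞 K) * b ^ 3) * hb)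
  have hd : |NumberField.discr K| ≤ (63644 : ℕ) :=
    abs_discr_le_of_sq_mul_le K (k := 2) (by norm_num)
      (sq_mul_abs_discr_le_abs_cubic_discr K h3 b hirr hb (by norm_num) 1 0 1 ⟨ω, hω⟩ (by norm_num))
      (by simp only [Cubic.discr]; norm_num)
  -- second generator `b2 = (33 + -2θ + -1θ²)/2`, a root of `X³ + (-1)X² + (-112)X + (-270)` (index 7, prime to 2)
  obtain ⟨b2, -, hb2⟩ := exists_intElem_of_scaled_cubic K b 33 (-2) (-1) (m := 2) (by norm_num) (-1) (-112) (-270)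
    (by push_cast; linear_combination ((177 : 𝓞 K) + (31 : 𝓞 K) * b + (-7 : 𝓞 K) * b ^ 2 + (-1 : 𝓞 K) * b ^ 3) * hb)
  have hirr2 := irreducible_cubic_d63644p
  refine classNumber_eq_one_of_prime_norm_principal K h3 (B := 72)
    (minkowskiBound_lt_of_sqrt_le K h3 hd (s := 252.28)
      ((Real.sqrt_le_sqrt (by norm_num : ((63644 : ℕ) : ℝ) ≤ (252.28 : ℝ) ^ 2)).trans (Real.sqrt_sq (by norm_num)).le)
      (by norm_num)) ?_
  intro ℓ hℓB hℓ J hJ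
  interval_cases ℓ <;> norm_num at hℓ
  · -- `ℓ = 2`: roots [0, 1] (second generator `b2`)
    refine isPrincipal_of_absNorm_eq_prime K h3 b2 hirr2 hb2 (by norm_num) (fun a ha hdvd => ?_) hJ
    interval_cases a <;> norm_num at hdvd
    · exact ⟨64, 19, (-2), by norm_num, by norm_num⟩
    · exact ⟨29, 11, 0, by norm_num, by norm_num⟩
  · -- `ℓ = 3`: roots [1]
    refine isPrincipal_of_absNorm_eq_prime K h3 b hirr hb (by norm_num) (fun a ha hdvd => ?_) hJ
    interval_cases a <;> norm_num at hdvd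
    · exact ⟨31, (-3), (-1), by norm_num, by norm_num⟩
  · -- `ℓ = 5`: roots [0, 2, 4]
    refine isPrincipal_of_absNorm_eq_prime K h3 b hirr hb (by norm_num) (fun a ha hdvd => ?_) hJ
    interval_cases a <;> norm_num at hdvd
    · exact ⟨(-25), 16, (-2), by norm_num, by norm_num⟩
    · exact ⟨(-2), 1, 0, by norm_num, by norm_num⟩
    · exact ⟨(-1811), 601, 117, by norm_num, by norm_num⟩
  · -- `ℓ = 7`: roots [3, 6]
    refine isPrincipal_of_absNorm_eq_prime K h3 b hirr hb (by norm_num) (fun a ha hdvd => ?_) hJ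
    interval_cases a <;> norm_num at hdvd
    · exact ⟨108, (-36), (-7), by norm_num, by norm_num⟩
    · exact ⟨6, (-1), 0, by norm_num, by norm_num⟩
  · -- `ℓ = 11`: roots none
    refine isPrincipal_of_absNorm_eq_prime K h3 b hirr hb (by norm_num) (fun a ha hdvd => ?_) hJ
    interval_cases a <;> norm_num at hdvd
  · -- `ℓ = 13`: roots none
    refine isPrincipal_of_absNorm_eq_prime K h3 b hirr hb (by norm_num) (fun a ha hdvd => ?_) hJ
    interval_cases a <;> norm_num at hdvd
  · -- `ℓ = 17`: roots none
    refine isPrincipal_of_absNorm_eq_prime K h3 b hirr hb (by norm_num) (fun a ha hdvd => ?_) hJ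
    interval_cases a <;> norm_num at hdvd
  · -- `ℓ = 19`: roots [0]
    refine isPrincipal_of_absNorm_eq_prime K h3 b hirr hb (by norm_num) (fun a ha hdvd => ?_) hJ
    interval_cases a <;> norm_num at hdvd
    · exact ⟨(-266), 7, 6, by norm_num, by norm_num⟩
  · -- `ℓ = 23`: roots none
    refine isPrincipal_of_absNorm_eq_prime K h3 b hirr hb (by norm_num) (fun a ha hdvd => ?_) hJ
    interval_cases a <;> norm_num at hdvd
  · -- `ℓ = 29`: roots [25]
    refine isPrincipal_of_absNorm_eq_prime K h3 b hirr hb (by norm_num) (fun a ha hdvd => ?_) hJ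
    interval_cases a <;> norm_num at hdvd
    · exact ⟨7, 5, (-1), by norm_num, by norm_num⟩
  · -- `ℓ = 31`: roots none
    refine isPrincipal_of_absNorm_eq_prime K h3 b hirr hb (by norm_num) (fun a ha hdvd => ?_) hJ
    interval_cases a <;> norm_num at hdvd
  · -- `ℓ = 37`: roots none
    refine isPrincipal_of_absNorm_eq_prime K h3 b hirr hb (by norm_num) (fun a ha hdvd => ?_) hJ
    interval_cases a <;> norm_num at hdvd
  · -- `ℓ = 41`: roots [22]
    refine isPrincipal_of_absNorm_eq_prime K h3 b hirr hb (by norm_num) (fun a ha hdvd => ?_) hJ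
    interval_cases a <;> norm_num at hdvd
    · exact ⟨998, (-629), 76, by norm_num, by norm_num⟩
  · -- `ℓ = 43`: roots none
    refine isPrincipal_of_absNorm_eq_prime K h3 b hirr hb (by norm_num) (fun a ha hdvd => ?_) hJ
    interval_cases a <;> norm_num at hdvd
  · -- `ℓ = 47`: roots none
    refine isPrincipal_of_absNorm_eq_prime K h3 b hirr hb (by norm_num) (fun a ha hdvd => ?_) hJ
    interval_cases a <;> norm_num at hdvd
  · -- `ℓ = 53`: roots none
    refine isPrincipal_of_absNorm_eq_prime K h3 b hirr hb (by norm_num) (fun a ha hdvd => ?_) hJ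
    interval_cases a <;> norm_num at hdvd
  · -- `ℓ = 59`: roots [57]
    refine isPrincipal_of_absNorm_eq_prime K h3 b hirr hb (by norm_num) (fun a ha hdvd => ?_) hJ
    interval_cases a <;> norm_num at hdvd
    · exact ⟨(-92), 58, (-7), by norm_num, by norm_num⟩
  · -- `ℓ = 61`: roots [28]
    refine isPrincipal_of_absNorm_eq_prime K h3 b hirr hb (by norm_num) (fun a ha hdvd => ?_) hJ
    interval_cases a <;> norm_num at hdvd
    · exact ⟨(-2353), 1488, (-180), by norm_num, by norm_num⟩
  · -- `ℓ = 67`: roots [18]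
    refine isPrincipal_of_absNorm_eq_prime K h3 b hirr hb (by norm_num) (fun a ha hdvd => ?_) hJ
    interval_cases a <;> norm_num at hdvd
    · exact ⟨(-78), 26, 5, by norm_num, by norm_num⟩
  · -- `ℓ = 71`: roots [18]
    refine isPrincipal_of_absNorm_eq_prime K h3 b hirr hb (by norm_num) (fun a ha hdvd => ?_) hJ
    interval_cases a <;> norm_num at hdvd
    · exact ⟨(-219), 5, 5, by norm_num, by norm_num⟩

end Certificate

/-! ## §2 The census row `445508b1` -/

/-- **(A)₂ for `445508b1` from ONE parity bit** (was: two bits, `conjA_two_445508b1_of_twoBits`): the parity of `h(ℚ(θ))` is now KERNEL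
(`h = 1`, `classNumber_eq_one_of_root_d63644p`, transported along `ℚ(θ) = ℚ(θ₁)` for the root `θ₁ = -71/7 + (-5/7)θ + (1/7)θ²` of the certificate's model), so only
«`e_1 = 0` along the cyclotomic `ℤ₂`-extensions of `ℚ(θ)`» = `2 ∤ h(ℚ(θ, √2))` (census `cyc6 = []`) stays displayed; granted `hLim2` BY NAME.
`θ` is any root of `X³ + (-1)X² + (-112)X + (-270)`. [cite: Lim2017FineSelmer, §3 Thm. 3.5 and Lemma 3.2] [cite: Fukuda1994, Thm. 1 (1), p. 264]
[cite: Cohen1993, §6.3] -/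
theorem conjA_two_445508b1_of_layerOneBit
    (hLim2 : Lim2017.thm35_at_two_fineSelmerDual_moduleFinite_of_classicalMuVanishes_of_le_divisionField_four)
    {θ : AlgebraicClosure ℚ} (hθ : aeval θ (Cubic.toPoly ⟨1, ((-1 : ℤ) : ℚ), ((-112 : ℤ) : ℚ), ((-270 : ℤ) : ℚ)⟩) = 0)
    (h1 : haveI : FiniteDimensional ℚ (IntermediateField.adjoin ℚ {θ}) :=
        IntermediateField.adjoin.finiteDimensional ((AlgebraicClosure.isAlgebraic ℚ).isAlgebraic θ).isIntegral
      haveI : NumberField (IntermediateField.adjoin ℚ {θ}) := NumberField.mk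
      ∀ κL : ZpExtension (IntermediateField.adjoin ℚ {θ}) 2, κL.IsCyclotomic → classNumberPExp κL 1 = 0)
    (κ : ZpExtension ℚ 2) (hκ : κ.IsCyclotomic) :
    haveI := isElliptic_445508b1'
    ∃ (γ : absoluteGaloisGroup ℚ) (D : (⟨0, ((-1 : ℤ) : ℚ), 0, ((-14574772 : ℤ) : ℚ), ((-21411754440 : ℤ) : ℚ)⟩ : WeierstrassCurve ℚ).FineSelmerDualData κ γ),
      Module.Finite ℤ_[2] (RestrictScalars ℤ_[2] (IwasawaAlgebra 2) D.X) := by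
  haveI := isElliptic_445508b1'
  have hθ' : θ ^ 3 + (-1 : AlgebraicClosure ℚ) * θ ^ 2 + (-112 : AlgebraicClosure ℚ) * θ + (-270 : AlgebraicClosure ℚ) = 0 := by
    have := hθ
    simp only [Cubic.toPoly, map_one, one_mul, aeval_add, aeval_mul, aeval_C, aeval_X_pow, aeval_X,
      eq_ratCast, Rat.cast_intCast] at this
    push_cast at this
    linear_combination this
  set θ₁ : AlgebraicClosure ℚ := algebraMap ℚ (AlgebraicClosure ℚ) (-71 / 7 : ℚ) +
      algebraMap ℚ (AlgebraicClosure ℚ) (-5 / 7 : ℚ) * θ + algebraMap ℚ (AlgebraicClosure ℚ) (1 / 7 : ℚ) * θ ^ 2 with hθ₁def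
  have hθ₁ : aeval θ₁ (Cubic.toPoly ⟨1, ((-1 : ℤ) : ℚ), ((-47 : ℤ) : ℚ), ((95 : ℤ) : ℚ)⟩) = 0 := by
    simp only [Cubic.toPoly, map_one, one_mul, aeval_add, aeval_mul, aeval_C, aeval_X_pow, aeval_X, eq_ratCast,
      Rat.cast_intCast]
    rw [hθ₁def]
    simp only [eq_ratCast]
    push_cast
    linear_combination (((730 : AlgebraicClosure ℚ) / 343) + ((-47 : AlgebraicClosure ℚ) / 343) * θ + ((-2 : AlgebraicClosure ℚ) / 49) * θ ^ 2 + ((1 : AlgebraicClosure ℚ) / 343) * θ ^ 3) * hθ'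
  have hadj : IntermediateField.adjoin ℚ {θ₁} = IntermediateField.adjoin ℚ {θ} := by
    apply le_antisymm
    · rw [IntermediateField.adjoin_simple_le_iff, hθ₁def]
      have hθmem := IntermediateField.mem_adjoin_simple_self ℚ θ
      exact add_mem (add_mem (algebraMap_mem _ _) (mul_mem (algebraMap_mem _ _) hθmem))
        (mul_mem (algebraMap_mem _ _) (pow_mem hθmem 2))
    · rw [IntermediateField.adjoin_simple_le_iff]
      have hθeq : θ = algebraMap ℚ (AlgebraicClosure ℚ) (33 / 2 : ℚ) + algebraMap ℚ (AlgebraicClosure ℚ) (-1 : ℚ) * θ₁ +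
          algebraMap ℚ (AlgebraicClosure ℚ) (-1 / 2 : ℚ) * θ₁ ^ 2 := by
        rw [hθ₁def]; simp only [eq_ratCast]; push_cast; linear_combination (((-9 : AlgebraicClosure ℚ) / 98) + ((1 : AlgebraicClosure ℚ) / 98) * θ) * hθ'
      rw [hθeq]
      have hθ₁mem := IntermediateField.mem_adjoin_simple_self ℚ θ₁
      exact add_mem (add_mem (algebraMap_mem _ _) (mul_mem (algebraMap_mem _ _) hθ₁mem))
        (mul_mem (algebraMap_mem _ _) (pow_mem hθ₁mem 2))
  have hh : ¬ 2 ∣ Nat.card (ClassGroup (𝓞 (IntermediateField.adjoin ℚ {θ}))) := by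
    rw [← hadj]
    exact not_two_dvd_card_classGroup_adjoin_of_forall_cubicField irreducible_cubic_d63644p_min (classNumber_eq_one_of_root_d63644p) hθ₁
  exact conjA_two_445508b1_of_twoBits hLim2 hθ hh h1 κ hκ

end Summit.BirchSwinnertonDyer.BirchSwinnertonDyer.Theorems.AddKatoTwo

end
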